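import Literature.Probability.Percolation.ZdFiveArmUpperBoundOfScheme
import Literature.Probability.Percolation.ZdFiveArmOutLandedE
import Literature.Probability.Percolation.ZdFiveArmSepENonvacuity
import Literature.Probability.Percolation.ZdFiveArmSepEInwardExtProb
import HarnessLib

/-!
# The `ℤ²` five-arm upper bound from the two applications of the arm-separation lemma

Topic `Literature/Probability/Percolation`; critical bond percolation on `ℤ²`. PROOFS ONLY.

With the outer-landed five-arm event `zdFiveArmOutLandedE` (`ZdFiveArmOutLandedE.lean`) now
defined and non-decreasing in the inner radius, and the inputs `(ext)`
(`exists_real_zdFiveArmSepE_le_mul_inward`, `ZdFiveArmSepEInwardExtProb.lean`) and `(init)`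
(`exists_pos_le_real_zdFiveArmSepE`, `ZdFiveArmSepENonvacuity.lean`) of the five-arm separation
scheme proved, the named fact `DuminilCopinManolescuTassion2021_zdFiveArm_upperBound` is reduced
(`DuminilCopinManolescuTassion2021_zdFiveArm_upperBound_of_outLanded`) to exactly the two
applications of Kesten's arm-separation lemma (Kesten 1987, Lemma 4 = Nolin 2008, Lemma 14 and
its internal analogue Lemma 15) for bond percolation on `ℤ²` with five arms:

* `(out)` the external half: `P(zdFiveArmClusters n N) ≤ C · P(zdFiveArmOutLandedE n N)`;
* `(in)` the inner step-and-landing: for every `ε > 0`, events `G m N` with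
  `P(zdFiveArmOutLandedE m N) ≤ P(G m N) + ε · P(zdFiveArmOutLandedE 2m N)` and
  `P(G 2m N) ≤ C₁ · P(zdFiveArmSepE m N)` (`n₂ ≤ m`, `4m ≤ N`).

## References

* H. Duminil-Copin, I. Manolescu, V. Tassion, PTRF 181 (2021), §6.3 Prop. 6.6
  [DuminilCopinManolescuTassion2021].
* H. Kesten, *Scaling relations for 2D-percolation*, CMP 109 (1987), §2 Lemmas 4–5
  [KestenScalingCMP1987].
* P. Nolin, *Near-critical percolation in two dimensions*, EJP 13 (2008), §4.4 Thm. 11, Lemmas 14–15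
  [arXiv 0711.4948: Thm. 10] [Nolin2008].
-/

noncomputable section

open MeasureTheory Set SimpleGraph

namespace Literature.Probability.Percolation

open LatticeModels

/-- **The `ℤ²` five-arm upper bound from the external half and the inner step-and-landing of
Kesten's arm separation** for the outer-landed event `zdFiveArmOutLandedE` and the well-separated
event `zdFiveArmSepE`: the inputs `(ext)` and `(init)` of
`DuminilCopinManolescuTassion2021_zdFiveArm_upperBound_of_separationInputs` are
`exists_real_zdFiveArmSepE_le_mul_inward` and `exists_pos_le_real_zdFiveArmSepE`, and the
monotonicity in the inner radius is `zdFiveArmOutLandedE_mono_left` (applied to the family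
`(m, N) ↦ zdFiveArmOutLandedE (min m N) N`, which agrees with `zdFiveArmOutLandedE` wherever the
scheme reads it). [cite: DuminilCopinManolescuTassion2021, §6.3 Prop. 6.6, q = 1] [cite: Nolin2008, §4.4 Thm. 11, Lemmas 14–15 (arXiv 0711.4948: Thm. 10)] [cite: KestenScalingCMP1987, §2 Lemmas 4–5] -/
theorem DuminilCopinManolescuTassion2021_zdFiveArm_upperBound_of_outLanded
    (hout : ∃ (C : ℝ) (n₀ : ℕ), 0 < C ∧ ∀ n N : ℕ, n₀ ≤ n → 2 * n ≤ N →
      (bondPercolation (zdGraph 2) half).real (zdFiveArmClusters n N) ≤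
        C * (bondPercolation (zdGraph 2) half).real (zdFiveArmOutLandedE n N))
    (hin : ∀ ε : ℝ, 0 < ε → ∃ (C₁ : ℝ) (n₂ : ℕ) (G : ℕ → ℕ → Set (BondConfig (Site 2))), 0 ≤ C₁ ∧
      (∀ m N : ℕ, n₂ ≤ m → 4 * m ≤ N →
        (bondPercolation (zdGraph 2) half).real (zdFiveArmOutLandedE m N) ≤
          (bondPercolation (zdGraph 2) half).real (G m N) +
            ε * (bondPercolation (zdGraph 2) half).real (zdFiveArmOutLandedE (2 * m) N)) ∧
      (∀ m N : ℕ, n₂ ≤ m → 4 * m ≤ N →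
        (bondPercolation (zdGraph 2) half).real (G (2 * m) N) ≤
          C₁ * (bondPercolation (zdGraph 2) half).real (zdFiveArmSepE m N))) :
    DuminilCopinManolescuTassion2021_zdFiveArm_upperBound := by
  obtain ⟨C₀, hC₀, hext⟩ := exists_real_zdFiveArmSepE_le_mul_inward
  obtain ⟨c, hc, hinit⟩ := exists_pos_le_real_zdFiveArmSepE
  set O : ℕ → ℕ → Set (BondConfig (Site 2)) := fun m N => zdFiveArmOutLandedE (min m N) N with hO
  have hOeq : ∀ m N : ℕ, m ≤ N → O m N = zdFiveArmOutLandedE m N := fun m N h => by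
    simp only [hO, min_eq_left h]
  have hmono : ∀ m m' N : ℕ, m' ≤ m → O m' N ⊆ O m N := fun m m' N h =>
    zdFiveArmOutLandedE_mono_left (min_le_min_right N h) (min_le_right m N)
  refine DuminilCopinManolescuTassion2021_zdFiveArm_upperBound_of_separationInputs O hmono ?_ (n₁ := 2048)
    hC₀ hc (fun m m' N' h1 h2 h3 h4 => hext m m' N' (by omega) h2 h3 h4) hinit fun ε hε => ?_
  · obtain ⟨C, n₀, hC, h⟩ := hout
    refine ⟨C, n₀, hC, fun n N hn hN => ?_⟩
    rw [hOeq n N (by omega)]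
    exact h n N hn hN
  · obtain ⟨C₁, n₂, G, hC₁, hstep, hland⟩ := hin ε hε
    refine ⟨C₁, n₂, G, hC₁, fun m N hm hN => ?_, hland⟩
    rw [hOeq m N (by omega), hOeq (2 * m) N (by omega)]
    exact hstep m N hm hN

end Literature.Probability.Percolation
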